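import Summits.BirchSwinnertonDyer.Rank1Residual.F1Sign2.SelmerUnitsAtTwo
import Literature.NumberTheory.EllipticCurves.RootNumber
import Literature.NumberTheory.EllipticCurves.QuadraticTwist
import Literature.NumberTheory.EllipticCurves.GlobalMinimalModel
import Mathlib.NumberTheory.Padics.PadicNumbers
import Mathlib.RingTheory.TensorProduct.Basic
import Mathlib.RingTheory.Trace.Basic
import HarnessLib

/-!
# Cell `bsd-f1-sign2`, lens `-desc` g12 (MEMO-desc §20): the THETA-DISCREPANCY CLASS `u_{E,F}` of a `2`-congruence and the
# `2`-Selmer PARITY-TRANSFER LAW along `E[2] ≅ F[2]` — DESC-§20-P (LEAD), DESC-§20-W, DESC-§20-T (PROVED), DESC-§20-I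

STATEMENTS + ONE PROOF: twelve carriers WITH BODIES (`twoDivisionRoot`, `twoDivisionDifferent`, `thetaDiscrepancyAtTwo`, `IsLocSquareAt`,
`LocSqIndependentAt`, `HasLocSqDimAt`, `locSqSpanAt`, `conicGramAtTwo`, `ConicIsotropicAt`, `IsLocalParitySymbolAt`, `InTransportedKummerImageAtTwo`,
`InRealKummerImageAtTwo`), four plain `def … : Prop` rows (P, W, T, I; theorem-candidates, NOT conjectures, nothing asserted) and the PROOF of row T
(`thetaDiscrepancyTrivialForTwistsAtTwo_holds`, with `derivative_twoDivisionUCubic`, `twoDivisionUCubic_quadraticTwist`, `aeval_twist_twoDivisionRoot`,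
`exists_algHom_twist_twoDivisionRoot`); no `instance`, no `notation`, no named Literature fact, no `sorry`.

TYPER FILING (seat `bsd-f1-sign2-ty` g7; CANDIDATES.md rows DESC-§20-P / -W / -T / -I; -desc g12 CANDIDATES-delta 2026-08-28T05:38:07Z «file as
`F1Sign2/ThetaDiscrepancy(Parity)AtTwo.lean` importing `SelmerUnitsAtTwo` when -ref1 clears»): bodies VERBATIM from `HOME/MEMO-desc-data/g12/Sketch-v15.lean`
089a4893334dc778 (-desc: `lean check --json` rc 0 · 0 err · 0 warn · 0 sorry; BC7 `Probe-v15.out` f593c49256a777bc 4/4 `VERDICT: CLEAN`) — builder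
`tools/mk_desc20.py` applies: this header; REF1-AUDIT §77's riders c1 (conic = period–index obstruction is O'Neil 2002 / Zarhin as quoted in Poonen–Rains §4.1,
not PR Prop 4.8 / Thm 4.13; ONE numbering = arXiv:1009.0287, checked first-hand: Cor. 4.6 p0013 L167, Prop. 4.8 p0014 L27, Prop. 4.10 p0014 L121, Prop. 4.12
p0014 L160, Thm. 4.13 p0015 L71, Rem. 4.14 p0015 L160), c3 (Green–Maistret 2022 / Dokchitser–Maistret 2023 as NEAREST PRINT; «beyond print as far as
searched» struck), c4 + ρ1 (the kernel `R_S` sentence), t1 (row T: the unused binder `t ≠ 0` DROPPED — the statement filed is the sketch's with one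
hypothesis fewer, hence stronger, and PROVED here by REF1's probe proof `REF1-data/b77/Probe_V15desc.lean` e23ab30adf2ca4d3 §twist, ported); bib keys normalised
to `references.bib` (`Fisher2006HessianI` ↦ `Fisher2012Hessian`, `MazurRubin2012SelmerCompanion` ↦ `MazurRubin2015SelmerCompanions`,
`DokchitserDokchitser2011` ↦ `DokchitserDokchitser2011Crelle`; `GreenMaistret2022`, `DokchitserMaistret2023`, `ONeil2002` added).
REF1-AUDIT-v1 §77 (2026-08-28T06:46:04Z; evidence `HOME/REF1-data/b77/`: Sketch-v15 compiled VERBATIM under ns `…F1Sign2.REF1b77` with 19 audit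
examples/theorems, rc 0 · 0 sorry · 0 warnings · 16 s; kit j301449 rider ρ1 scan): **DESC-§20-P SURVIVES as a THEOREM-GRADE statement (paper proof
re-derived line by line against Poonen–Rains 2012 and Green–Maistret 2022), NOT vacuous, typed row faithful** (e1 parse of the exponent by `rfl`; e2–e7
junk-at-0 harmless because a `LocSqIndependentAt` family has no locally-square member and `twoDivisionAlgebra E` is a field under `Fact (Irreducible c_E)`;
`HasLocSqDimAt D m` pins `m`; for every `(E,F,ψ,S)` and every `p ∈ S` the hypothesis `IsLocalParitySymbolAt … (d p) (c p)` is satisfiable by exactly one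
pair, likewise `(d₀,c₀)` — at `r₁ = 1` the real symbol is `(0,0)` (e10/e11)); `[IsGloballyMinimal]` only makes «p ∣ conductorNorm» = «bad for the model»;
`2 ∈ S` and BOTH conductors load-bearing. **DESC-§20-W SURVIVES, theorem-grade, ⟺ P modulo print** (Monsky 1996 Thm 1.5 + Cassels–Tate; global content
KNOWN). **DESC-§20-T PROVED** (std axioms {propext, Classical.choice, Quot.sound}; hypothesis on `ψ` satisfiable via `AdjoinRoot.liftAlgHom`).
**DESC-§20-I SURVIVES, TRUE and elementary** (Euler `Tr(1/c′(θ)) = 0`, explicit ℚ-point `z = u⁻¹`; Lean route `Module.Basis.traceDual_powerBasis_eq` +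
`trace_traceDual_mul` — a prover S-item, left as a plain def here). PARTITION none; beyond-print theorem: NO (global), formula-level residue only.
REF2-PLACEMENT v17 §11 (2026-08-28T06:15:41Z): Q1 YES — **Green–Maistret 2022** (Proc. R. Soc. A 478:20220112) Thm 1.3 = Thm 6.4 [corpus arxiv-2110.06718
p0003 L29–30, p0012 L39–41] «if E₁[2] ≅ E₂[2] as Galois modules, the 2-parity conjecture holds for E₁/K iff it holds for E₂/K», with the LOCAL theorem
Thm 2.11 (p0005 L109–111: `w_{E/𝒦} w_{Jac E′/𝒦} = λ_{f,𝒦}·𝓔`, 𝓔 an explicit Hilbert-symbol gauge, Def 2.8), Thm 2.4 = Dokchitser–Maistret 2023 Thm 3.2, and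
the reduction Lemma 6.3 (p0012 L17–37) of an arbitrary non-twist `2`-congruent pair to `(y² = f, d y² = x f)`; hence the GLOBAL content of P and all of
W are IN PRINT (isogeny currency); the DESCENT-currency decomposition `κ_v = d_v + c_v` via the class `u` and the explicit `u = c_E′(θ)·ψ(c_F′(θ′))`
with `S_{α,F} = S_{αu,E}` are unrecorded (object in print: CFOSS I Prop 1.31 — theta groups for E[n] form an H¹(K,E[n])-torsor; conic in print:
Bhargava–Gross AIT, Cremona 2001). Grade: **VARIANT / new bookkeeping of a printed parity law; beyond-print NO**; decisive next step = the GM-dictionary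
table on j299249 (Outcome A: §20 is GM in descent clothing / Outcome B: `(−1)^{κ_v}·λ_{f,v}` a new local sign with product formula).
CENSUS / BC5 (-desc g12, kit tag bsd-frontier-data; `MEMO-desc-data/g12/` SHA16SUMS): j299104 (T1 conic-shift test: 216 pairs / 119 469 local samples /
9 732 informative, 0 failures), j299224 (smoke, 120 pairs `N < 4000`: law 120/120), **j299249** (full, `job-j299249/CENSUS4.txt` f78963fab6f4e855: 4 000
pairs from the 346 764 odd-torsion Cremona curves `N < 10⁵` grouped by cubic `2`-division field; analysed 3 678 non-twist + 308 twist (14 timeouts, 0 errors):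
LAW `s₂(E)+s₂(F) ≡ Σκ_v` **3 678/3 678 + 308/308**, also with roles swapped and in the closed form `Σ(d_v + c_v)`; two `s₂`-parity engines (Cremona rank +
2-parity, PARI `ellrank`) agree 3 981/3 981; per place 12 698 rows (8 003 odd + 3 986 at `p = 2` + 709 real): two square-class oracles agree 12 698/12 698,
four engines for `c_v` agree 12 698/12 698, `u_v ∈ δE + δF` in all 1 432 rows with `u_v ∉ δE ∪ δF`; the NAIVE Kramer sum (all `c_v = 0`) is WRONG in
956/3 678 non-twist pairs — cheapest falsifier of P = one congruent pair violating the parity → 0/3 986 → NOT KILLED; TERMWISE sign law in the trivial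
gauge REFUTED by the same census (odd 4 068 agree / 3 935 fail; `p = 2` 2 440 / 1 546) and NOT filed).
PARTITION: none moved; beyond-print theorem: no. bears_on: cell search question (descent lens, MEMO-desc §20 Q20.1 local gauge) — no registered
statement item consumes these rows at filing.

Planner's summary (verbatim): Sketch-v15 (planner `-desc` g12, MEMO-desc §20): the THETA-DISCREPANCY CLASS of a `2`-congruence and the
`2`-Selmer PARITY-TRANSFER LAW along `E[2] ≅ F[2]`

Two curves `E, F / ℚ` with `E(ℚ)[2] = F(ℚ)[2] = 0` and ISOMORPHIC cubic `2`-division fields (`ψ : L_F ≃ L_E`, i.e. `E[2] ≅ F[2]`)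
carry ONE canonical global class `u = u_{E,F} = [c_E′(θ_E) · ψ(c_F′(θ_F))] ∈ ker N = H¹(ℚ, E[2])` (the discrepancy of the two
theta groups / Euler dual bases; trivial for quadratic twists). The Poonen–Rains quadratic forms satisfy `q_F = q_E + ⟨·, u⟩`
(conic identity `S_{α,F} = S_{αu,E}`), whence the PARITY-TRANSFER LAW
`s₂(E) − s₂(F) ≡ Σ_v d_v(E,F) + #C(E,F) (mod 2)` with `d_v = dim(δ_v(E)+δ_v(F)) − dim δ_v(E)` (Kramer's term) and the
CORRECTION SET `C = {v : u_v ∉ δ_v(E) ∪ δ_v(F), u_v = a·b′ (a ∈ δ_v(E), b′ ∈ δ_v(F)) with the conic S_{b′,E} anisotropic over ℚ_v}`.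
Carriers reused: `twoDivisionUCubic`, `twoDivisionAlgebra`, `InExplicitLocalKummerImageAtTwo`, `IsBranchRealRoot`, `selmerTwoCard`,
`WeierstrassCurve.rootNumber`, `WeierstrassCurve.quadraticTwist`, `WeierstrassCurve.conductorNorm`.
Statements only (`def … : Prop`); nothing asserted; no `sorry`; no `instance`. [-desc; the typer adds the proof of row T, see above.]
-/

noncomputable section

open scoped Classical TensorProduct

open WeierstrassCurve Polynomial NumberField

namespace Summit.BirchSwinnertonDyer.Rank1Residual.F1Sign2

/-- `θ_W = AdjoinRoot.root c_W`, the tautological root of the `2`-division cubic in `L_W`. -/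
abbrev twoDivisionRoot (W : WeierstrassCurve ℚ) : twoDivisionAlgebra W := AdjoinRoot.root (twoDivisionUCubic W)

/-- `c_W′(θ_W) ∈ L_W` (the different of `θ_W`; `N(c_W′(θ_W)) = −disc c_W`). -/
def twoDivisionDifferent (W : WeierstrassCurve ℚ) : twoDivisionAlgebra W :=
  aeval (twoDivisionRoot W) (derivative (twoDivisionUCubic W))

/-- **The THETA-DISCREPANCY CLASS** of a `2`-congruence `ψ : L_F → L_E` (a `ℚ`-algebra map between the cubic `2`-division
algebras; when both cubics are irreducible it is an isomorphism of cubic fields, i.e. an identification `E[2] ≅ F[2]`):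
`u_{E,F} := c_E′(θ_E) · ψ(c_F′(θ_F)) ∈ L_E` (same square class as the quotient `c_E′(θ_E)/ψ(c_F′(θ_F))`). Its norm is
`disc(c_E)·disc(c_F) ∈ ℚ^{×2}` (equal `2`-division fields), so its square class lies in `ker N = H¹(ℚ, E[2])`, unramified outside
`2·N_E·N_F·∞`; it is independent of the models. Dictionary: `u` is the class of the theta group `Θ_F` in the `H¹(ℚ, E[2])`-torsor of
theta groups for `E[2]` based at `Θ_E`; the `2`-covering conics satisfy `S_{α,F} = S_{α·u,E}`. (REF2 v17 §11.2: the CLASS is a printed object — CFOSS I Prop. 1.31 «theta groups for E[n], as twists of Θ_E, are parametrised by H¹(K, E[n])»;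
the explicit representative `c_E′(θ_E)·ψ(c_F′(θ_F))` and the identity `S_{α,F} = S_{αu,E}` were not found in print — folklore-level, three lines from
Euler's `Tr(·/c′(θ))`.) [cite: CremonaFisherONeilSimonStoll2008, Lemma 1.30, Prop. 1.31] [cite: PoonenRains2012, §4.1 (theta characteristic torsor)]
[cite: Fisher2012Hessian, §12 (theta groups, n = 2; -desc cites Thm. 12.5 of the arXiv version and the remark following it)] -/
def thetaDiscrepancyAtTwo (E F : WeierstrassCurve ℚ) (ψ : twoDivisionAlgebra F →ₐ[ℚ] twoDivisionAlgebra E) :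
    twoDivisionAlgebra E :=
  twoDivisionDifferent E * ψ (twoDivisionDifferent F)

/-! ## Local square-class calculus at a completion `K = ℚ_p` or `ℝ` (explicit side, global representatives) -/

/-- `x ∈ L_W` is a square in `L_W ⊗_ℚ K`. -/
def IsLocSquareAt (W : WeierstrassCurve ℚ) (K : Type) [CommRing K] [Algebra ℚ K] (x : twoDivisionAlgebra W) : Prop :=
  IsSquare (x ⊗ₜ[ℚ] (1 : K) : twoDivisionAlgebra W ⊗[ℚ] K)

/-- A finite family of elements of `L_W` is independent modulo squares of `L_W ⊗ K` (no non-empty sub-product is a local square).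
(`LocSqIndependentAtTwo` of `F1Sign2/LocalKummerParityAtTwo.lean` is the case `K = ℚ₂`.) -/
def LocSqIndependentAt (W : WeierstrassCurve ℚ) (K : Type) [CommRing K] [Algebra ℚ K] {ι : Type} (β : ι → twoDivisionAlgebra W) :
    Prop :=
  ∀ s : Finset ι, s.Nonempty → ¬ IsLocSquareAt W K (∏ i ∈ s, β i)

/-- The subgroup of `(L_W ⊗ K)^×/□` cut out by the membership predicate `D` (assumed multiplicatively closed modulo local squares)
has `𝔽₂`-dimension exactly `m`: `m` members independent modulo local squares whose sub-products represent every member. -/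
def HasLocSqDimAt (W : WeierstrassCurve ℚ) (K : Type) [CommRing K] [Algebra ℚ K] (D : twoDivisionAlgebra W → Prop) (m : ℕ) :
    Prop :=
  ∃ β : Fin m → twoDivisionAlgebra W,
    (∀ i, D (β i)) ∧ LocSqIndependentAt W K β ∧ ∀ x, D x → ∃ s : Finset (Fin m), IsLocSquareAt W K (x * ∏ i ∈ s, β i)

/-- The product predicate `D₁·D₂` (classes `x ≡ y·z` with `D₁ y`, `D₂ z`, `y, z ≠ 0` — the explicit membership predicates are
junk-true at `0`): membership in the SUM of the two subgroups of `(L_W ⊗ K)^×/□`. -/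
def locSqSpanAt (W : WeierstrassCurve ℚ) (K : Type) [CommRing K] [Algebra ℚ K] (D₁ D₂ : twoDivisionAlgebra W → Prop)
    (x : twoDivisionAlgebra W) : Prop :=
  ∃ y z, y ≠ 0 ∧ z ≠ 0 ∧ D₁ y ∧ D₂ z ∧ IsLocSquareAt W K (x * y * z)

/-- Gram matrix over `ℚ` of the `2`-COVERING CONIC `S_{b,W} : Tr_{L_W/ℚ}(b · c_W′(θ_W) · z²) = 0` (`z = z₀ + z₁θ + z₂θ²`; this is the
classical conic `{θ²-coefficient of b z² = 0} = {Tr(b z²/c_W′(θ)) = 0}` rescaled by the square `c_W′(θ)²`). Its class in `Br(K)[2]`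
is the period–index obstruction of `b` = the value `q_{W,K}(b)` of the Poonen–Rains quadratic form (REF1 §77 c1: the identification
«q = obstruction = class of the Brauer–Severi conic» is O'Neil 2002 §2 Prop. 2.3 / Zarhin, as quoted in Poonen–Rains §4.1 Case II; PR Cor. 4.6 = q is a
quadratic form with polar form ∓ the cup product; arXiv:1009.0287 numbering). [cite: ONeil2002, §2 (Prop. 2.3)]
[cite: PoonenRains2012, §4.1 Case II (p. 13) and Cor. 4.6] -/
def conicGramAtTwo (W : WeierstrassCurve ℚ) (b : twoDivisionAlgebra W) (i j : Fin 3) : ℚ :=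
  Algebra.trace ℚ (twoDivisionAlgebra W) (b * twoDivisionDifferent W * twoDivisionRoot W ^ (i : ℕ) * twoDivisionRoot W ^ (j : ℕ))

/-- The conic `S_{b,W}` has a `K`-point (`q_{W,K}(b) = 0`). -/
def ConicIsotropicAt (W : WeierstrassCurve ℚ) (K : Type) [CommRing K] [Algebra ℚ K] (b : twoDivisionAlgebra W) : Prop :=
  ∃ z : Fin 3 → K, z ≠ 0 ∧ ∑ i, ∑ j, algebraMap ℚ K (conicGramAtTwo W b i j) * z i * z j = 0

/-- **The LOCAL PARITY SYMBOL data** of the pair at a completion `K`, for local Kummer predicates `DE = δ_v(E)` and `DF = δ_v(F)` (the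
latter read inside `L_E` through `ψ`) and `u` the theta-discrepancy: `d = dim(δ_v(E)+δ_v(F)) − dim δ_v(E)` (Kramer's local term) and the
CORRECTION BIT `c = 1` iff `u ∉ δ_v(E) ∪ δ_v(F)` and `u ≡ a·b′` with `a ∈ δ_v(E)`, `b′ ∈ δ_v(F)` and `S_{b′,E}` ANISOTROPIC over `K`
(the value is independent of the decomposition; `c = 0` when `u ∉ δ_v(E)+δ_v(F)`). `κ_v := d + c (mod 2)` is the parity, for ANY
subspace `Λ ∋ u_v` maximal isotropic for `q_{E,v}`, of `codim(δ_v(E) ∩ Λ ⊂ δ_v(E)) + codim(δ_v(F) ∩ Λ ⊂ δ_v(F))` (choice-free). -/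
def IsLocalParitySymbolAt (E : WeierstrassCurve ℚ) (K : Type) [CommRing K] [Algebra ℚ K]
    (DE DF : twoDivisionAlgebra E → Prop) (u : twoDivisionAlgebra E) (d c : ℕ) : Prop :=
  (∃ n, HasLocSqDimAt E K DE n ∧ HasLocSqDimAt E K DF n ∧ HasLocSqDimAt E K (locSqSpanAt E K DE DF) (n + d)) ∧
    (c = if (¬ DE u ∧ ¬ DF u ∧ ∃ a b, a ≠ 0 ∧ b ≠ 0 ∧ DE a ∧ DF b ∧ IsLocSquareAt E K (u * a * b) ∧ ¬ ConicIsotropicAt E K b)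
      then 1 else 0)

/-- Explicit local Kummer condition of `F` at a prime `p`, read inside `L_E` through `ψ`: `x ≡ ψ(β)` modulo squares of `L_E ⊗ ℚ_p` for
some `β ∈ L_F` whose class lies in `δ_p(F(ℚ_p))` (`InExplicitLocalKummerImageAtTwo F p β`). -/
def InTransportedKummerImageAtTwo (E F : WeierstrassCurve ℚ) (ψ : twoDivisionAlgebra F →ₐ[ℚ] twoDivisionAlgebra E) (p : ℕ)
    [Fact p.Prime] (x : twoDivisionAlgebra E) : Prop :=
  ∃ β : twoDivisionAlgebra F, β ≠ 0 ∧ InExplicitLocalKummerImageAtTwo F p β ∧ IsLocSquareAt E ℚ_[p] (x * ψ β)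

/-- Explicit REAL Kummer condition for the cubic `c` with root `e ∈ L_E` (the curve `Y² = c(X)` read in `L_E`): the class of `x` in
`(L_E ⊗ ℝ)^×/□` lies in `δ_∞ = {1, egg class}` — `x` is totally positive, or `x` has the EGG sign type of `c` (`σ x > 0` iff `σ e` is the
smallest real root of `c`). For one real place (`disc < 0`) the first disjunct is automatic for norm-square classes (`δ_∞ = H¹ = 0`).
[cite: BrumerKramer1977, §2 (archimedean condition)] -/
def InRealKummerImageAtTwo (E : WeierstrassCurve ℚ) [Fact (Irreducible (twoDivisionUCubic E))] (c : ℚ[X])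
    (e x : twoDivisionAlgebra E) : Prop :=
  (∀ σ : twoDivisionAlgebra E →+* ℝ, 0 < σ x) ∨
    ∀ σ : twoDivisionAlgebra E →+* ℝ, σ x ≠ 0 ∧ (0 < σ x ↔ IsBranchRealRoot (twoDivisionAlgebra E) σ c e false)

/-- **DESC-§20-P (LEAD; THEOREM-GRADE per REF1-AUDIT §77 — paper proof complete; a plain def, nothing asserted; GLOBAL CONTENT IN PRINT per
REF2 v17 §11: Green–Maistret 2022 Thm 1.3 = 6.4 with the local Thm 2.11, Thm 2.4 (= Dokchitser–Maistret 2023 Thm 3.2) and Lemma 6.3, in ISOGENY currency;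
over `ℚ` with `E(ℚ)[2] = 0` already Monsky 1996 + Cassels; the DESCENT-currency local terms `κ_v = d_v + c_v` and the class `u` are a VARIANT —
beyond-print: NO).** THE `2`-SELMER PARITY-TRANSFER LAW ALONG A
`2`-CONGRUENCE. `E, F / ℚ` globally minimal, `c_E, c_F` irreducible (`E(ℚ)[2] = F(ℚ)[2] = 0`), `ψ : L_F → L_E` a `ℚ`-algebra map
(`E[2] ≅ F[2]`), `u = u_{E,F}` the theta-discrepancy, `S ∋ 2` a finite set of primes containing every prime of bad reduction of `E` or
`F`. If `(d_p, c_p)_{p ∈ S}` and `(d_∞, c_∞)` are the local parity symbols (`IsLocalParitySymbolAt` at `ℚ_p`, resp. `ℝ`, for the explicit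
Kummer conditions of `E` and of `F` transported by `ψ`), then
`dim Sel₂(E) + dim Sel₂(F) + Σ_{p ∈ S} (d_p + c_p) + d_∞ + c_∞` is EVEN.
PROOF SKETCH (MEMO-desc §20.3): `q_F = q_E + ⟨·,u⟩` on `⊕_v H¹(ℚ_v, E[2])` (conic identity `S_{α,F} = S_{αu,E}`, Euler's dual basis);
`G = Im H¹(ℤ_S, E[2])`, `W_E = ⊕δ_v(E)`, `W_F = ⊕δ_v(F)` and any `Λ = ⊕Λ_v` with `u_v ∈ Λ_v` maximal `q_E`-isotropic are maximal isotropic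
(`G, Λ` for both forms); the two-family parity `dim(X ∩ Y) ≡ n + [X ≁ Y]` applied to `(G, W_E), (G, Λ)` in `(V, q_E)` and `(G, W_F), (G, Λ)`
in `(V, q_F)` gives `s₂(E) + s₂(F) ≡ Σ_v κ_v`; `κ_v = d_v + c_v` by the local computation of §20.3 (places outside `S ∪ {∞}` contribute `0`).
BOOKKEEPING (REF1 §77 ρ1/c4): `G := Im H¹(ℤ_S, E[2])`, `W_X := ⊕_{v ∈ S ∪ ∞} δ_v(X)`; the map `Sel₂(X) → G ∩ W_X` is onto (PR Rem. 4.14: «the intersection of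
the images equals the image of Sel») with kernel `R_S = {c unramified outside S, c_v = 0 ∀ v ∈ S ∪ ∞} ≅ (Cl(𝒪_{L,S})/2)^∨`, `L = ℚ(θ_E) ≅ ℚ(θ_F)` the
common cubic field — the SAME for `X = E, F` — so `s₂(X) = dim(G ∩ W_X) + rk₂ Cl(𝒪_{L,S})` and the law is a statement about `dim(G ∩ W_E) − dim(G ∩ W_F)`
(`Ш¹(ℚ, E[2]) = 0` for `S₃/C₃` image holds but is not the relevant kernel).
Twist case (`u = 1`, all `c_v = 0`): Kramer 1981 Thm 1 / Klagsbrun–Mazur–Rubin 2013 Thm 3.9. CENSUS = BC5 witness (kit j299224 smoke,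
120 pairs `N < 4000`; full census j299249: MEMO-desc §20.5): law 120/120 with the `s₂`-parity from two engines (Cremona rank + 2-parity;
PARI `ellrank`), every local quantity from two square-class oracles, correction needed (naive Kramer sum wrong) in 30/111 non-twist pairs,
opposite Selmer parity in 48/111. WHY IT MIGHT FAIL: only through the explicit dictionary (`δ_v` generated by rational `X`-coordinates;
conic normalisation at `p = 2`); the abstract law is a two-line consequence of Poonen–Rains. NEAREST PRINT (REF1 §77 c3 / REF2 v17 §11): Green–Maistret
2022 (same theorem, isogeny currency, every number field), Kramer 1981 Thm 1 = KMR 2013 Thm 3.9 (same currency, twists only), CFOSS I Prop 1.31 + PR 2012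
(the class `u`). [cite: GreenMaistret2022, Thm. 1.3 (= Thm. 6.4), Thm. 2.4, Thm. 2.11, Lemma 6.3] [cite: DokchitserMaistret2023, Thm. 3.2]
[cite: PoonenRains2012, Thm. 4.13, Rem. 4.14, Prop. 4.10, Prop. 4.12 (arXiv:1009.0287 numbering)]
[cite: Kramer1981, Thm. 1] [cite: KlagsbrunMazurRubin2013, Thm. 3.9] [cite: Monsky1996, Thm. 1.5]
[cite: MazurRubin2015SelmerCompanions, (context, not input: Selmer companions at p = 2 need E[4] ≅ F[4]; -desc cites Thm. 3.6 / §7.2 of arXiv:1203.0620)] -/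
def TwoSelmerParityTransferAlongCongruenceAtTwo : Prop :=
  ∀ (E F : WeierstrassCurve ℚ) [E.IsElliptic] [F.IsElliptic] [E.IsGloballyMinimal] [F.IsGloballyMinimal]
    [Fact (Irreducible (twoDivisionUCubic E))] [Fact (Irreducible (twoDivisionUCubic F))]
    (ψ : twoDivisionAlgebra F →ₐ[ℚ] twoDivisionAlgebra E) (S : Finset ℕ),
    2 ∈ S → (∀ p ∈ S, p.Prime) → (∀ p : ℕ, p.Prime → (p ∣ E.conductorNorm ℤ ∨ p ∣ F.conductorNorm ℤ) → p ∈ S) →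
    ∀ (d c : ℕ → ℕ) (d₀ c₀ : ℕ),
      (∀ (p : ℕ) [Fact p.Prime], p ∈ S →
        IsLocalParitySymbolAt E ℚ_[p] (InExplicitLocalKummerImageAtTwo E p) (InTransportedKummerImageAtTwo E F ψ p)
          (thetaDiscrepancyAtTwo E F ψ) (d p) (c p)) →
      IsLocalParitySymbolAt E ℝ (InRealKummerImageAtTwo E (twoDivisionUCubic E) (twoDivisionRoot E))
          (InRealKummerImageAtTwo E (twoDivisionUCubic F) (ψ (twoDivisionRoot F))) (thetaDiscrepancyAtTwo E F ψ) d₀ c₀ →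
        Even (Nat.log 2 (selmerTwoCard E) + Nat.log 2 (selmerTwoCard F) + ∑ p ∈ S, (d p + c p) + d₀ + c₀)

/-- **DESC-§20-W (theorem-grade; ⟺ DESC-§20-P modulo print — Monsky 1996 Thm 1.5 + Cassels–Tate — per REF1-AUDIT §77; its GLOBAL content
`(−1)^{s₂(E)+s₂(F)} = w(E)·w(F)` is KNOWN over every number field (Green–Maistret 2022 Thm 6.1/6.4 + Dokchitser–Dokchitser 2011 twist leg; REF2 v17 §11:
a CONSEQUENCE row, beyond-print NO); a ROOT-NUMBER identity with no Selmer group in it; a plain def, nothing asserted).**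
Same hypotheses: `(−1)^{Σ_{p ∈ S}(d_p + c_p) + d_∞ + c_∞} = w(E)·w(F)` — the product of the two global root numbers is the product of the
local parity symbols of the congruence. (From DESC-§20-P and `(−1)^{s₂(W)} = w(W)` for `W(ℚ)[2] = 0`: Monsky 1996 + Cassels.) In the twist
case this is the product over `v` of the Kramer–Tunnell local formula. TERMWISE it is FALSE in the trivial gauge (census: `(−1)^{κ_p} =
w_p(E)w_p(F)` fails at ~half the places) — the local gauge for a general `2`-congruence is the open question Q20.1 of MEMO-desc §20.
[cite: GreenMaistret2022, Thm. 1.3 (= Thm. 6.4), Thm. 6.1, Thm. 2.11] [cite: Monsky1996, Thm. 1.5]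
[cite: DokchitserDokchitser2011Crelle, (Kramer–Tunnell for quadratic twists; -desc cites Thm. 1.4)] [cite: PoonenRains2012, Thm. 4.13 (arXiv numbering)] -/
def RootNumberProductAlongCongruenceAtTwo : Prop :=
  ∀ (E F : WeierstrassCurve ℚ) [E.IsElliptic] [F.IsElliptic] [E.IsGloballyMinimal] [F.IsGloballyMinimal]
    [Fact (Irreducible (twoDivisionUCubic E))] [Fact (Irreducible (twoDivisionUCubic F))]
    (ψ : twoDivisionAlgebra F →ₐ[ℚ] twoDivisionAlgebra E) (S : Finset ℕ),
    2 ∈ S → (∀ p ∈ S, p.Prime) → (∀ p : ℕ, p.Prime → (p ∣ E.conductorNorm ℤ ∨ p ∣ F.conductorNorm ℤ) → p ∈ S) →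
    ∀ (d c : ℕ → ℕ) (d₀ c₀ : ℕ),
      (∀ (p : ℕ) [Fact p.Prime], p ∈ S →
        IsLocalParitySymbolAt E ℚ_[p] (InExplicitLocalKummerImageAtTwo E p) (InTransportedKummerImageAtTwo E F ψ p)
          (thetaDiscrepancyAtTwo E F ψ) (d p) (c p)) →
      IsLocalParitySymbolAt E ℝ (InRealKummerImageAtTwo E (twoDivisionUCubic E) (twoDivisionRoot E))
          (InRealKummerImageAtTwo E (twoDivisionUCubic F) (ψ (twoDivisionRoot F))) (thetaDiscrepancyAtTwo E F ψ) d₀ c₀ →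
        (-1 : ℤ) ^ (∑ p ∈ S, (d p + c p) + d₀ + c₀) = E.rootNumber * F.rootNumber

/-- **DESC-§20-T (support; PROVED below as `thetaDiscrepancyTrivialForTwistsAtTwo_holds` — REF1-AUDIT §77 probe proof, ported; typer edit per rider t1:
the sketch's unused hypothesis `t ≠ 0` is dropped, so this is the sketch's statement with one binder fewer).** For a QUADRATIC TWIST `F = E^{(t)}` the theta-discrepancy is TRIVIAL: the
cubic of `E^{(t)}` is `t³ c_E(X/t)`, its root `t·θ_E` defines `ψ`, and `c_{E^{(t)}}′(tθ_E) = t² c_E′(θ_E)`, so `u = (t c_E′(θ_E))²`. Hence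
all correction bits vanish and DESC-§20-P specialises to Kramer's formula. Census: 9/9 twist pairs of the smoke, 18/18 in j299104.
[cite: Kramer1981, Thm. 1] -/
def ThetaDiscrepancyTrivialForTwistsAtTwo : Prop :=
  ∀ (E : WeierstrassCurve ℚ) (t : ℚ) (ψ : twoDivisionAlgebra (E.quadraticTwist t) →ₐ[ℚ] twoDivisionAlgebra E),
    ψ (twoDivisionRoot (E.quadraticTwist t)) = algebraMap ℚ (twoDivisionAlgebra E) t * twoDivisionRoot E →
      IsSquare (thetaDiscrepancyAtTwo E (E.quadraticTwist t) ψ)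

/-- **DESC-§20-I (support; TRUE and elementary per REF1-AUDIT §77 — explicit ℚ-point `z =` coordinates of `u⁻¹`; Lean route `AdjoinRoot.powerBasis` +
`Module.Basis.traceDual_powerBasis_eq` + `trace_traceDual_mul`; left to a prover as an S-item; a plain def, nothing asserted: the local lemma behind the
correction bit).** At every completion, the theta-discrepancy is
`q_E`- and `q_F`-ISOTROPIC: the conics `S_{u,E}` and `S_{u,F}` have rational points GLOBALLY (the point `z = 1`: `Tr_{L/ℚ}(1/c′(θ)) = 0`
for a cubic — Euler), so `(u ∪ u)_v = 0` everywhere. Typed over `ℚ` (which implies every completion). Census: `trok` 120/120. -/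
def ThetaDiscrepancyConicsSplitAtTwo : Prop :=
  ∀ (E F : WeierstrassCurve ℚ) [Fact (Irreducible (twoDivisionUCubic E))] [Fact (Irreducible (twoDivisionUCubic F))]
    (ψ : twoDivisionAlgebra F →ₐ[ℚ] twoDivisionAlgebra E),
    ConicIsotropicAt E ℚ (thetaDiscrepancyAtTwo E F ψ)


/-! ## Row T PROVED (REF1-AUDIT §77, `HOME/REF1-data/b77/Probe_V15desc.lean` §twist, ported by the typer; std axioms) -/

/-- `c_W′ = 3X² + 2b₂X + 8b₄`. -/
theorem derivative_twoDivisionUCubic (W : WeierstrassCurve ℚ) :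
    derivative (twoDivisionUCubic W) = C 3 * X ^ 2 + C (2 * W.b₂) * X + C (8 * W.b₄) := by
  simp only [twoDivisionUCubic, derivative_add, derivative_mul, derivative_C, derivative_X_pow, derivative_X,
    zero_mul, zero_add, map_mul]
  norm_num
  ring

/-- The twist's cubic: `c_{W^{(t)}}(X) = X³ + t b₂ X² + 8 t² b₄ X + 16 t³ b₆ = t³ c_W(X/t)` (tree `quadraticTwist_b₂/₄/₆`). -/
theorem twoDivisionUCubic_quadraticTwist (W : WeierstrassCurve ℚ) (t : ℚ) :
    twoDivisionUCubic (W.quadraticTwist t) =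
      X ^ 3 + C (t * W.b₂) * X ^ 2 + C (8 * (t ^ 2 * W.b₄)) * X + C (16 * (t ^ 3 * W.b₆)) := by
  simp only [twoDivisionUCubic, quadraticTwist_b₂, quadraticTwist_b₄, quadraticTwist_b₆]

/-- **Row T holds**: for `F = E^{(t)}` and `ψ(θ_{E^{(t)}}) = t·θ_E`,
`u = c_E′(θ_E) · ψ(c′_{E^{(t)}}(θ_{E^{(t)}})) = c_E′(θ_E) · c′_{E^{(t)}}(tθ_E) = (t · c_E′(θ_E))²`. -/
theorem thetaDiscrepancyTrivialForTwistsAtTwo_holds : ThetaDiscrepancyTrivialForTwistsAtTwo := by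
  intro E t ψ hψ
  refine ⟨algebraMap ℚ (twoDivisionAlgebra E) t * twoDivisionDifferent E, ?_⟩
  unfold thetaDiscrepancyAtTwo twoDivisionDifferent
  rw [← Polynomial.aeval_algHom_apply, hψ]
  simp only [derivative_twoDivisionUCubic, quadraticTwist_b₂, quadraticTwist_b₄, map_add, map_mul, map_pow, map_ofNat,
    aeval_C, aeval_X]
  ring

/-- Row T's hypothesis is SATISFIABLE (not vacuous): `t·θ_E` is a root of the twist's cubic in `L_E` … -/
theorem aeval_twist_twoDivisionRoot (E : WeierstrassCurve ℚ) (t : ℚ) :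
    aeval (algebraMap ℚ (twoDivisionAlgebra E) t * twoDivisionRoot E) (twoDivisionUCubic (E.quadraticTwist t)) = 0 := by
  have h0 : aeval (twoDivisionRoot E) (X ^ 3 + C E.b₂ * X ^ 2 + C (8 * E.b₄) * X + C (16 * E.b₆)) = 0 := by
    rw [show (X ^ 3 + C E.b₂ * X ^ 2 + C (8 * E.b₄) * X + C (16 * E.b₆) : ℚ[X]) = twoDivisionUCubic E from rfl,
      AdjoinRoot.aeval_eq, AdjoinRoot.mk_self]
  rw [twoDivisionUCubic_quadraticTwist]
  simp only [map_add, map_mul, map_pow, map_ofNat, aeval_C, aeval_X] at h0 ⊢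
  linear_combination (algebraMap ℚ (twoDivisionAlgebra E) t) ^ 3 * h0

/-- … so `ψ := AdjoinRoot.liftAlgHom` exists with `ψ(θ_{E^{(t)}}) = t·θ_E` (for every `t`). -/
theorem exists_algHom_twist_twoDivisionRoot (E : WeierstrassCurve ℚ) (t : ℚ) :
    ∃ ψ : twoDivisionAlgebra (E.quadraticTwist t) →ₐ[ℚ] twoDivisionAlgebra E,
      ψ (twoDivisionRoot (E.quadraticTwist t)) = algebraMap ℚ (twoDivisionAlgebra E) t * twoDivisionRoot E :=
  ⟨AdjoinRoot.liftAlgHom _ (Algebra.ofId ℚ _) _ (by simpa [Polynomial.aeval_def] using aeval_twist_twoDivisionRoot E t),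
    by simp [twoDivisionRoot]⟩


/-! ## Row I PROVED (-ty g7 append, 2026-08-28; REF1-AUDIT §77's route: Euler `Tr(1/c′(θ)) = 0` via `Module.Basis.traceDual_powerBasis_eq` + `trace_traceDual_mul`,
explicit `ℚ`-point `z` = coordinates of `u⁻¹`; std axioms). Rows T and I are now THEOREMS in the tree; P and W remain plain defs. CANDIDATES.md row DESC-§20-I. -/

/-- The `u`-cubic is monic (twin of the Theorems-side `AlignedTransportAtTwoBridge.monic_twoDivisionUCubic`, not importable here). [folklore] -/
theorem twoDivisionUCubic_monic (W : WeierstrassCurve ℚ) : (twoDivisionUCubic W).Monic := by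
  unfold twoDivisionUCubic; monicity!

/-- The `u`-cubic has degree `3` (twin of `AlignedTransportAtTwoBridge.natDegree_twoDivisionUCubic`). [folklore] -/
theorem twoDivisionUCubic_natDegree (W : WeierstrassCurve ℚ) : (twoDivisionUCubic W).natDegree = 3 := by
  unfold twoDivisionUCubic; compute_degree!

/-- `L_W = ℚ(θ_W)` is a cubic extension of `ℚ`. -/
theorem finrank_twoDivisionAlgebra (W : WeierstrassCurve ℚ) [Fact (Irreducible (twoDivisionUCubic W))] :
    Module.finrank ℚ (twoDivisionAlgebra W) = 3 := by
  rw [(AdjoinRoot.powerBasis (twoDivisionUCubic_monic W).ne_zero).finrank, AdjoinRoot.powerBasis_dim, twoDivisionUCubic_natDegree]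

/-- `L_W` is finite-dimensional over `ℚ` (a local instance for the trace-form lemmas). -/
theorem finiteDimensional_twoDivisionAlgebra (W : WeierstrassCurve ℚ) [Fact (Irreducible (twoDivisionUCubic W))] :
    FiniteDimensional ℚ (twoDivisionAlgebra W) :=
  (AdjoinRoot.powerBasis (twoDivisionUCubic_monic W).ne_zero).finite

/-- `θ_W` is a root of `c_W` (stated without the `Fact (Irreducible _)` instance, so that `aeval` uses the `AdjoinRoot` algebra structure of `twoDivisionDifferent`). -/
theorem aeval_twoDivisionRoot_twoDivisionUCubic (W : WeierstrassCurve ℚ) :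
    aeval (twoDivisionRoot W) (twoDivisionUCubic W) = 0 := by
  rw [AdjoinRoot.aeval_eq, AdjoinRoot.mk_self]

/-- `c_W′(θ_W) ≠ 0` (the cubic is irreducible over `ℚ`, hence separable). -/
theorem twoDivisionDifferent_ne_zero (W : WeierstrassCurve ℚ) [Fact (Irreducible (twoDivisionUCubic W))] :
    twoDivisionDifferent W ≠ 0 := by
  have hirr : Irreducible (twoDivisionUCubic W) := Fact.out
  unfold twoDivisionDifferent
  exact hirr.separable.aeval_derivative_ne_zero (aeval_twoDivisionRoot_twoDivisionUCubic W)

/-- **Euler**: `Tr_{L_W/ℚ}(1/c_W′(θ_W)) = 0` for the cubic field `L_W = ℚ(θ_W)` (the `θ²`-coefficient of `1` is `0`). -/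
theorem trace_inv_twoDivisionDifferent (W : WeierstrassCurve ℚ) [Fact (Irreducible (twoDivisionUCubic W))] :
    Algebra.trace ℚ (twoDivisionAlgebra W) (twoDivisionDifferent W)⁻¹ = 0 := by
  have hf0 : twoDivisionUCubic W ≠ 0 := (twoDivisionUCubic_monic W).ne_zero
  haveI := finiteDimensional_twoDivisionAlgebra W
  let pb : PowerBasis ℚ (twoDivisionAlgebra W) := AdjoinRoot.powerBasis hf0
  have hdim : pb.dim = 3 := by show (AdjoinRoot.powerBasis hf0).dim = 3; rw [AdjoinRoot.powerBasis_dim, twoDivisionUCubic_natDegree]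
  have hgen : pb.gen = twoDivisionRoot W := AdjoinRoot.powerBasis_gen hf0
  have hmin : minpoly ℚ pb.gen = twoDivisionUCubic W := AdjoinRoot.minpoly_powerBasis_gen_of_monic (twoDivisionUCubic_monic W)
  let i2 : Fin pb.dim := ⟨2, by omega⟩
  let i0 : Fin pb.dim := ⟨0, by omega⟩
  have hint : IsIntegral ℚ pb.gen := pb.isIntegral_gen
  have hdeg : (minpolyDiv ℚ pb.gen).natDegree = 2 := by
    have h := natDegree_minpolyDiv_succ hint; rw [hmin, twoDivisionUCubic_natDegree] at h; omega
  have hc : (minpolyDiv ℚ pb.gen).coeff 2 = 1 := by rw [← hdeg]; exact (minpolyDiv_monic hint).coeff_natDegree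
  have hdual : pb.basis.traceDual i2 = (twoDivisionDifferent W)⁻¹ := by
    rw [Module.Basis.traceDual_powerBasis_eq, hmin]
    change (minpolyDiv ℚ pb.gen).coeff 2 / aeval pb.gen (derivative (twoDivisionUCubic W)) = _
    rw [hc, hgen, one_div]
    rfl
  have htr := pb.basis.trace_traceDual_mul i2 i0
  rw [hdual, PowerBasis.coe_basis] at htr
  simpa [i0, i2, Fin.ext_iff] using htr

/-- **DESC-§20-I holds** (REF1-AUDIT §77: TRUE and elementary): the conic `S_{u,E}` has the rational point `z =` coordinates of `u⁻¹`,
because `Q(u⁻¹) = Tr(u · c_E′(θ) · u⁻²) = Tr(1/ψ(c_F′(θ_F))) = Tr_{L_F/ℚ}(1/c_F′(θ_F)) = 0` (Euler). -/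
theorem thetaDiscrepancyConicsSplitAtTwo_holds : ThetaDiscrepancyConicsSplitAtTwo := by
  intro E F _ _ ψ
  haveI := finiteDimensional_twoDivisionAlgebra E
  haveI := finiteDimensional_twoDivisionAlgebra F
  have hf0 : twoDivisionUCubic E ≠ 0 := (twoDivisionUCubic_monic E).ne_zero
  let pb : PowerBasis ℚ (twoDivisionAlgebra E) := AdjoinRoot.powerBasis hf0
  have hdim : pb.dim = 3 := by show (AdjoinRoot.powerBasis hf0).dim = 3; rw [AdjoinRoot.powerBasis_dim, twoDivisionUCubic_natDegree]
  have hgen : pb.gen = twoDivisionRoot E := AdjoinRoot.powerBasis_gen hf0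
  have hψinj : Function.Injective ψ := ψ.toRingHom.injective
  have hψbij : Function.Bijective ψ :=
    ⟨hψinj, (LinearMap.injective_iff_surjective_of_finrank_eq_finrank
      (by rw [finrank_twoDivisionAlgebra, finrank_twoDivisionAlgebra]) (f := ψ.toLinearMap)).mp hψinj⟩
  let e : twoDivisionAlgebra F ≃ₐ[ℚ] twoDivisionAlgebra E := AlgEquiv.ofBijective ψ hψbij  -- ψ is an iso of cubic fields
  set u := thetaDiscrepancyAtTwo E F ψ with hu_def
  have hdE : twoDivisionDifferent E ≠ 0 := twoDivisionDifferent_ne_zero E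
  have hdF : ψ (twoDivisionDifferent F) ≠ 0 := by rw [map_ne_zero_iff ψ hψinj]; exact twoDivisionDifferent_ne_zero F
  have hu : u ≠ 0 := mul_ne_zero hdE hdF
  let z : Fin 3 → ℚ := fun i ↦ pb.basis.repr u⁻¹ (Fin.cast hdim.symm i)
  have hw : ∑ i : Fin 3, z i • twoDivisionRoot E ^ (i : ℕ) = u⁻¹ := by
    have h := pb.basis.sum_repr u⁻¹
    rw [PowerBasis.coe_basis, hgen] at h; rw [← h]
    exact Fintype.sum_equiv (finCongr hdim.symm) _ _ (fun i ↦ rfl)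
  refine ⟨z, fun hz ↦ inv_ne_zero hu (by rw [← hw]; simp [hz]), ?_⟩  -- `z ≠ 0` as `u⁻¹ ≠ 0`; next `Q(z) = Tr(u c′ u⁻²) = 0`
  · have key : ∀ i j : Fin 3, algebraMap ℚ ℚ (conicGramAtTwo E u i j) * z i * z j =
        Algebra.trace ℚ (twoDivisionAlgebra E)
          (u * twoDivisionDifferent E * ((z i • twoDivisionRoot E ^ (i : ℕ)) * (z j • twoDivisionRoot E ^ (j : ℕ)))) := by
      intro i j
      simp only [conicGramAtTwo, Algebra.algebraMap_self, RingHom.id_apply, mul_smul_comm, smul_mul_assoc,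
        map_smul, smul_eq_mul, mul_assoc]
      ac_rfl
    simp_rw [key, ← map_sum, ← Finset.mul_sum]
    rw [← Finset.sum_mul, hw]
    have : u * twoDivisionDifferent E * (u⁻¹ * u⁻¹) = (ψ (twoDivisionDifferent F))⁻¹ := by
      rw [hu_def]; simp only [thetaDiscrepancyAtTwo]; field_simp; exact div_self hdF
    rw [this, ← map_inv₀]
    change Algebra.trace ℚ (twoDivisionAlgebra E) (e (twoDivisionDifferent F)⁻¹) = 0
    rw [Algebra.trace_eq_of_algEquiv, trace_inv_twoDivisionDifferent]

end Summit.BirchSwinnertonDyer.Rank1Residual.F1Sign2
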